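import Literature.Geometry.Riemannian.MCFComparisonPrinciple
import HarnessLib

/-!
# Translation invariance of classical mean curvature flows of `ℝⁿ⁺¹`; weak set flows keep their
# distance from classical flows

Topic `Literature/Geometry/Riemannian`. Two structural facts about the tree's mean curvature flow
vocabulary (`IsClassicalMCF`, `IsWeakSetFlowIn`, `levelSetFlow` of `MeanConvexLevelSetFlow.lean`)
in Euclidean space:

* **Translation invariance.** For an immersed hypersurface `f : N → V` of a Euclidean space with
  normal field `ν`, the translate `y ↦ f y + v` has the same differential
  (`hasMFDerivAt_add_const`), induced form (`inducedBilin_add_const`), unit normal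
  (`isUnitNormal_add_const`), second fundamental form and mean curvature
  (`secondFundamentalForm_add_const`, `meanCurvature_add_const`; via the flat formulas
  `K(u, w) = ⟪dν u, df w⟫` of `EuclideanHypersurfaceContact.lean`); hence a classical mean
  curvature flow translated by a fixed vector is a classical mean curvature flow
  (`IsClassicalMCF.add_const`).
* **Quantitative avoidance** (White 2000, §2): the avoidance axiom of weak set flows (disjoint
  from a classical flow at time `a` ⇒ disjoint on `[a, b]`) upgrades, by testing against all
  small translates of the classical flow, to **distance monotonicity**: if `‖F(a, ·) - z‖ ≥ δ` on
  `K a` then `‖F(t, ·) - z‖ ≥ δ` on `K t`, `t ∈ [a, b]`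
  (`IsWeakSetFlowIn.le_norm_sub_of_forall`, `levelSetFlow_le_norm_sub_of_forall`).

Everything is PROVED; no definitions, no named facts.

## References

* B. White, *The size of the singular set in mean curvature flow of mean-convex sets*, J. Amer.
  Math. Soc. 13 (2000), §2. [White2000]
* O. Hershkovits, B. White, Comm. Pure Appl. Math. 73 (2020), Appendix, Def. 19.
  [HershkovitsWhite2019]
* C. Mantegazza, *Lecture Notes on Mean Curvature Flow* (2011), §1.1. [Mantegazza2011]
-/

noncomputable section

open Bundle Set Function Metric Module Filter
open scoped Manifold ContDiff Topology RealInnerProductSpace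

namespace Literature.Geometry.Riemannian

open Lorentzian Lorentzian.PseudoRiemannianMetric EuclideanHypersurface

/-! ### Translating an immersed hypersurface of Euclidean space -/

section Translate

variable {E' : Type*} [NormedAddCommGroup E'] [NormedSpace ℝ E']
  {H' : Type*} [TopologicalSpace H'] {I' : ModelWithCorners ℝ E' H'}
  {N : Type*} [TopologicalSpace N] [ChartedSpace H' N]
  {V : Type*} [NormedAddCommGroup V] [InnerProductSpace ℝ V]

/-- The differential of a translate `y ↦ f y + v` is that of `f`. [folklore] -/
theorem hasMFDerivAt_add_const {f : N → V} (v : V) {x : N}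
    (hf : MDifferentiableAt I' 𝓘(ℝ, V) f x) :
    HasMFDerivAt I' 𝓘(ℝ, V) (fun y ↦ f y + v) x (mfderiv I' 𝓘(ℝ, V) f x) :=
  (hf.hasMFDerivAt.add (hasMFDerivAt_const (I := I') (I' := 𝓘(ℝ, V)) v x)).congr_mfderiv
    (add_zero _)

/-- Pointwise form: `d(f + v)_x w = df_x w`. [folklore] -/
theorem mfderiv_add_const_apply {f : N → V} (v : V) {x : N}
    (hf : MDifferentiableAt I' 𝓘(ℝ, V) f x) (w : TangentSpace I' x) :
    (mfderiv I' 𝓘(ℝ, V) (fun y ↦ f y + v) x : TangentSpace I' x →L[ℝ] V) w =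
      (mfderiv I' 𝓘(ℝ, V) f x : TangentSpace I' x →L[ℝ] V) w := by
  rw [(hasMFDerivAt_add_const v hf).mfderiv]
  rfl

/-- **A translate of a spacelike immersion is a spacelike immersion** (the induced forms agree).
[folklore] -/
theorem isSpacelikeImmersion_add_const {f : N → V}
    (hf : (euclideanMetric V).IsSpacelikeImmersion I' f) (v : V) :
    (euclideanMetric V).IsSpacelikeImmersion I' (fun y ↦ f y + v) := by
  refine ⟨hf.contMDiff.add contMDiff_const, fun y w hw ↦ ?_⟩
  have h := hf.inducedBilin_pos y hw
  have hd : MDifferentiableAt I' 𝓘(ℝ, V) f y := (hf.contMDiff y).mdifferentiableAt (by simp)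
  rw [inducedBilin_apply, euclideanMetric_apply] at h ⊢
  have e := mfderiv_add_const_apply v hd w
  have h' : 0 < ⟪(mfderiv I' 𝓘(ℝ, V) f y : TangentSpace I' y →L[ℝ] V) w,
      (mfderiv I' 𝓘(ℝ, V) f y : TangentSpace I' y →L[ℝ] V) w⟫ := h
  rw [← e] at h'
  exact h'

/-- The induced bilinear forms of `f` and of its translate agree. [folklore] -/
theorem inducedBilin_add_const {f : N → V} (hf : ContMDiff I' 𝓘(ℝ, V) 1 f) (v : V) (y : N)
    (u w : TangentSpace I' y) :
    (euclideanMetric V).inducedBilin I' (fun y ↦ f y + v) y u w =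
      (euclideanMetric V).inducedBilin I' f y u w := by
  have hd : MDifferentiableAt I' 𝓘(ℝ, V) f y := (hf y).mdifferentiableAt one_ne_zero
  rw [inducedBilin_apply, inducedBilin_apply, euclideanMetric_apply, euclideanMetric_apply]
  have e₁ := mfderiv_add_const_apply v hd u
  have e₂ := mfderiv_add_const_apply v hd w
  change ⟪(mfderiv I' 𝓘(ℝ, V) (fun y ↦ f y + v) y : TangentSpace I' y →L[ℝ] V) u,
      (mfderiv I' 𝓘(ℝ, V) (fun y ↦ f y + v) y : TangentSpace I' y →L[ℝ] V) w⟫ =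
    ⟪(mfderiv I' 𝓘(ℝ, V) f y : TangentSpace I' y →L[ℝ] V) u,
      (mfderiv I' 𝓘(ℝ, V) f y : TangentSpace I' y →L[ℝ] V) w⟫
  rw [e₁, e₂]
  rfl

/-- **A unit normal of `f` is a unit normal of every translate of `f`.** [folklore] -/
theorem isUnitNormal_add_const {f ν : N → V} (hf : ContMDiff I' 𝓘(ℝ, V) 1 f)
    (hν : (euclideanMetric V).IsUnitNormal I' f ν 1) (v : V) :
    (euclideanMetric V).IsUnitNormal I' (fun y ↦ f y + v) ν 1 := by
  refine ⟨fun y w ↦ ?_, fun y ↦ ?_⟩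
  · have hd : MDifferentiableAt I' 𝓘(ℝ, V) f y := (hf y).mdifferentiableAt one_ne_zero
    have h : ⟪ν y, (mfderiv I' 𝓘(ℝ, V) f y : TangentSpace I' y →L[ℝ] V) w⟫ = 0 :=
      hν.isNormalTo y w
    rw [← mfderiv_add_const_apply v hd w] at h
    exact h
  · exact hν.val_self y

variable [FiniteDimensional ℝ E'] [I'.Boundaryless] [IsManifold I' ∞ N] [FiniteDimensional ℝ V]
  [(euclideanMetric V).HasLeviCivita]

/-- **The second fundamental form is translation invariant**: `K_{f + v} = K_f` for the same
normal field (`K(u, w) = ⟪dν u, df w⟫`, `secondFundamentalForm_eq_inner`). [folklore] -/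
theorem secondFundamentalForm_add_const {f ν : N → V} (hf : ContMDiff I' 𝓘(ℝ, V) ∞ f)
    (hν : ContMDiff I' 𝓘(ℝ, V) ∞ ν) (v : V) (y : N) (u w : TangentSpace I' y) :
    (euclideanMetric V).secondFundamentalForm I' (fun y ↦ f y + v) ν y u w =
      (euclideanMetric V).secondFundamentalForm I' f ν y u w := by
  have hd : MDifferentiableAt I' 𝓘(ℝ, V) f y := (hf y).mdifferentiableAt (by simp)
  have hf' : ContMDiff I' 𝓘(ℝ, V) ∞ (fun y ↦ f y + v) := hf.add contMDiff_const
  have h1 := secondFundamentalForm_eq_inner hf' hν y u w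
  have h2 := secondFundamentalForm_eq_inner hf hν y u w
  rw [h1, h2, mfderiv_add_const_apply v hd w]

/-- **The mean curvature is translation invariant**: `H_{f + v}(y) = H_f(y)` for the same normal
field (trace over a common orthonormal frame of the equal induced metrics). [folklore] -/
theorem meanCurvature_add_const {f ν : N → V} (hpb : contMDiff_pullbackBilin 𝓘(ℝ, V) V I' N ∞)
    (hf : (euclideanMetric V).IsSpacelikeImmersion I' f) (v : V)
    (hf' : (euclideanMetric V).IsSpacelikeImmersion I' (fun y ↦ f y + v))
    (hν : ContMDiff I' 𝓘(ℝ, V) ∞ ν) (y : N) :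
    (euclideanMetric V).meanCurvature (fun y ↦ f y + v) hpb hf' ν y =
      (euclideanMetric V).meanCurvature f hpb hf ν y := by
  set g₁ := (euclideanMetric V).inducedMetric f hpb hf with hg₁
  set g₂ := (euclideanMetric V).inducedMetric (fun y ↦ f y + v) hpb hf' with hg₂
  have hval : ∀ u w : TangentSpace I' y, g₂.val y u w = g₁.val y u w := fun u w ↦ by
    rw [hg₁, hg₂, inducedMetric_val, inducedMetric_val]
    exact inducedBilin_add_const (hf.contMDiff_self.of_le (by simp)) v y u w
  have hpos : ∀ u : TangentSpace I' y, u ≠ 0 → 0 < g₁.val y u u :=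
    fun u hu ↦ isRiemannian_inducedMetric _ _ hpb hf y u hu
  obtain ⟨b, hb⟩ := g₁.exists_basis_isOrthonormalFrame hpos (m := finrank ℝ E') rfl
  have hb' : g₂.IsOrthonormalFrame y b :=
    ⟨fun i ↦ by rw [hval]; exact hb.1 i, fun i j hij ↦ by rw [hval]; exact hb.2 i j hij⟩
  rw [meanCurvature, meanCurvature, g₂.trace_eq_sum_of_isOrthonormalFrame b hb',
    g₁.trace_eq_sum_of_isOrthonormalFrame b hb]
  exact Finset.sum_congr rfl fun i _ ↦
    secondFundamentalForm_add_const hf.contMDiff_self hν v y (b i) (b i)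

end Translate

/-! ### Translation invariance of classical mean curvature flows of `ℝⁿ⁺¹` -/

section MCF

variable {n : ℕ} {N : Type*} [TopologicalSpace N] [ChartedSpace (EuclideanSpace ℝ (Fin n)) N]
  [IsManifold (𝓡 n) ∞ N] {F : ℝ → N → EuclideanSpace ℝ (Fin (n + 1))}
  {ν : (t : ℝ) → NormalField (𝓡 (n + 1)) (F t)} {a b : ℝ}

/-- **Mean curvature flow in `ℝⁿ⁺¹` is translation invariant**: if `(F, ν)` is a classical mean
curvature flow on `[a, b]` then so is `(F + v, ν)` for every fixed vector `v`
(all the data — induced metric, unit normal, second fundamental form, mean curvature, velocity —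
are unchanged: the equation `∂ₜF = -Hν` is invariant under the isometries of `ℝⁿ⁺¹`).
[folklore] -/
theorem IsClassicalMCF.add_const
    (h : IsClassicalMCF (euclideanMetric (EuclideanSpace ℝ (Fin (n + 1)))) F ν a b)
    (v : EuclideanSpace ℝ (Fin (n + 1))) :
    IsClassicalMCF (euclideanMetric (EuclideanSpace ℝ (Fin (n + 1)))) (fun t y ↦ F t y + v) ν
      a b := by
  obtain ⟨U, hU, hIU, hF⟩ := h.contMDiffOn
  have hνs : ∀ t ∈ Icc a b, ContMDiff (𝓡 n) 𝓘(ℝ, EuclideanSpace ℝ (Fin (n + 1))) ∞ (ν t) :=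
    fun t ht ↦ (contMDiff_of_contMDiff_lift (h.contMDiff_normal t ht)).2
  have hsp : ∀ t ∈ Icc a b, (euclideanMetric (EuclideanSpace ℝ (Fin (n + 1)))).IsSpacelikeImmersion
      (𝓡 n) (fun y ↦ F t y + v) :=
    fun t ht ↦ isSpacelikeImmersion_add_const (h.isSpacelikeImmersion t ht) v
  refine
    { compactSpace := h.compactSpace
      contMDiffOn := ⟨U, hU, hIU, hF.add contMDiffOn_const⟩
      isSpacelikeImmersion := hsp
      injective := fun t ht y₁ y₂ hy ↦ h.injective t ht (add_right_cancel hy)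
      isUnitNormal := fun t ht ↦ isUnitNormal_add_const
        ((h.isSpacelikeImmersion t ht).contMDiff_self.of_le (by simp)) (h.isUnitNormal t ht) v
      contMDiff_normal := fun t ht ↦ contMDiff_lift_of_contMDiff
        ((h.isSpacelikeImmersion t ht).contMDiff_self.add contMDiff_const) (hνs t ht)
      velocity_eq := fun t ht y ↦ ?_ }
  · -- velocity: `∂ₜ(F + v) = ∂ₜF = -H ν`, and `H_{F + v} = H_F`
    have hd : MDifferentiableAt 𝓘(ℝ, ℝ) 𝓘(ℝ, EuclideanSpace ℝ (Fin (n + 1))) (fun s ↦ F s y) t :=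
      ((contDiffAt_slice hU hF (hIU ht) y).differentiableAt (by simp)).mdifferentiableAt
    have e := (hasMFDerivAt_add_const (I' := 𝓘(ℝ, ℝ)) v hd).mfderiv
    rw [e, meanCurvature_add_const contMDiff_pullbackBilin_holds
      (h.isSpacelikeImmersion t ht) v (hsp t ht) (hνs t ht) y]
    exact h.velocity_eq t ht y

end MCF

/-! ### Weak set flows keep their distance from classical flows -/

section WeakAvoidance

variable {n : ℕ} {N : Type} [TopologicalSpace N] [ChartedSpace (EuclideanSpace ℝ (Fin n)) N]
  [IsManifold (𝓡 n) ∞ N] {F : ℝ → N → EuclideanSpace ℝ (Fin (n + 1))}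
  {ν : (t : ℝ) → NormalField (𝓡 (n + 1)) (F t)} {a b : ℝ} {I : Set ℝ}
  {K : ℝ → Set (EuclideanSpace ℝ (Fin (n + 1)))}

/-- **Quantitative avoidance (White 2000, §2): a weak set flow keeps its distance from a classical
flow.** If `K` is a weak set flow in `ℝⁿ⁺¹` on `I ⊇ [a, b]`, `(F, ν)` a classical mean curvature
flow on `[a, b]`, and `‖F(a, y) - z‖ ≥ δ` for all `y` and all `z ∈ K a`, then
`‖F(t, y) - z‖ ≥ δ` for all `t ∈ [a, b]`, `y`, `z ∈ K t`: otherwise the TRANSLATED classical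
flow `F + (z - F(t, y))` (`IsClassicalMCF.add_const`), disjoint from `K a` at time `a`, would
meet `K t` at time `t`, against the avoidance axiom of weak set flows. (The parameter manifold
`N` lives in `Type`, as required by the definition of weak set flows in `ℝⁿ⁺¹`.)
[cite: White2000, §2] [cite: HershkovitsWhite2019, Appendix Def. 19] -/
theorem IsWeakSetFlowIn.le_norm_sub_of_forall
    (hK : IsWeakSetFlowIn (euclideanMetric (EuclideanSpace ℝ (Fin (n + 1)))) univ I K)
    (hF : IsClassicalMCF (euclideanMetric (EuclideanSpace ℝ (Fin (n + 1)))) F ν a b)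
    (hab : a ≤ b) (hI : Icc a b ⊆ I) {δ : ℝ} (hδ : ∀ y, ∀ z ∈ K a, δ ≤ ‖F a y - z‖) {t : ℝ}
    (ht : t ∈ Icc a b) (y : N) {z : EuclideanSpace ℝ (Fin (n + 1))} (hz : z ∈ K t) :
    δ ≤ ‖F t y - z‖ := by
  by_contra hlt
  rw [not_le] at hlt
  set v : EuclideanSpace ℝ (Fin (n + 1)) := z - F t y with hv
  have hvn : ‖v‖ < δ := by rwa [hv, norm_sub_rev]
  have hflow := hF.add_const v
  have hdis : Disjoint (range fun y' ↦ F a y' + v) (K a) := by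
    refine Set.disjoint_left.2 ?_
    rintro _ ⟨y', rfl⟩ hmem
    have h1 := hδ y' _ hmem
    rw [sub_add_cancel_left, norm_neg] at h1
    linarith
  have key := hK.avoidance hab hI hflow (fun _ _ ↦ subset_univ _) hdis ht
  refine Set.disjoint_left.1 key ⟨y, ?_⟩ hz
  simp only [hv, add_sub_cancel]

/-- The same for the level set flow `F_t(K₀)` (union over all weak set flows from inside `K₀`):
lower bounds of `‖F(a, ·) - z‖`, `z ∈ F_a(K₀)` (`a ≥ 0`), persist on `[a, b]`.
[cite: White2000, §2] -/
theorem levelSetFlow_le_norm_sub_of_forall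
    (hF : IsClassicalMCF (euclideanMetric (EuclideanSpace ℝ (Fin (n + 1)))) F ν a b)
    (ha : 0 ≤ a) (hab : a ≤ b) {K₀ : Set (EuclideanSpace ℝ (Fin (n + 1)))} {δ : ℝ}
    (hδ : ∀ y, ∀ z ∈ levelSetFlow (euclideanMetric (EuclideanSpace ℝ (Fin (n + 1)))) K₀ a,
      δ ≤ ‖F a y - z‖) {t : ℝ} (ht : t ∈ Icc a b) (y : N) {z : EuclideanSpace ℝ (Fin (n + 1))}
    (hz : z ∈ levelSetFlow (euclideanMetric (EuclideanSpace ℝ (Fin (n + 1)))) K₀ t) :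
    δ ≤ ‖F t y - z‖ := by
  obtain ⟨-, K, hK, hK0, hzK⟩ := hz
  exact hK.le_norm_sub_of_forall hF hab (fun s hs ↦ ha.trans hs.1)
    (fun y' z' hz' ↦ hδ y' z' (subset_levelSetFlow hK hK0 ha hz')) ht y hzK

end WeakAvoidance

end Literature.Geometry.Riemannian

end
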